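import Summits.BirchSwinnertonDyer.BirchSwinnertonDyer.Theorems.GenusKolyvaginAtTwoGenusPrimitiveSupplyAtTwoTwistRamifiedTransversalRat
import Literature.NumberTheory.EllipticCurves.TwoDescentLocalSelmerOfExhibit
import Literature.NumberTheory.EllipticCurves.Kramer1981.RamifiedNormIndexLocalLemmas
import HarnessLib

/-!
# Route `GenusKolyvaginAtTwo`, crux #2 `GenusPrimitiveSupplyAtTwo` (stmt-BirchSwinnertonDyer-22136):
# `√d ∈ ℚ₂^{nr}` for `d ≡ 5 (mod 8)` — the dyadic unramifiedness input of Mazur–Rubin Lemma 2.10 (v) at `2`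

Width seat `bsd-line-gk2-p5` g10 (cell `bsd-f1-sign2`, SUPPLY lineage), file 36 of the series (input (b) of the crux memo
`Lines/genus-supply-mr-instantiation.md` §8b for the dyadic row of `MazurRubin2010.d2_eq_of_lemma210_rat`). THEOREMS ONLY (no definition,
no named fact, no `sorry`, no local instance); helper `--supports stmt-BirchSwinnertonDyer-22136`; no item is closed; BSD is not proved.

WHAT. The norm theorem of the tree (`KramerTunnell1982.relIndex_normSubgroup_fixedSubgroup_eq_one_of_isUnit_Δ`: good reduction and
`K' ≤ maxUnramified F` ⟹ every `F`-point is a norm from `K'`) needs, at the completion `F = ℚ_v` above `2`, that `ℚ_v(√d)` lie in the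
tree's maximal unramified extension `F(μ_{2'})` (`IsNonarchimedeanLocalField.maxUnramified`). For `d ≡ 5 (mod 8)`:
`ζ₃ ∈ μ_{2'}` (`3` is a `2`-adic unit), `(2ζ₃ + 1)² = −3`, and `−3d ≡ 1 (mod 8)` is a square `s²` in `ℚ_v` (tree
`isSquare_algebraMap_adicCompletion_two_of_res8`), so `√d = ± s(2ζ₃+1)/3 ∈ F(ζ₃) ⊆ F^{nr}`:

* §86 `valuation_adicCompletion_natCast_eq_one_of_not_mem` (`|n|_v = 1` for `n ∉ v`), `exists_cubeRootOfUnity_mem_maxUnramified`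
  (a primitive cube root of unity in `ℚ_v^{nr}`, `v ∣ 2`), **`closureEmb_geomSqrt_mem_maxUnramified_of_emod_eight_eq_five`** —
  `closureEmb(√d) ∈ ℚ_v^{nr}` for `v ∣ 2`, `d ≡ 5 (mod 8)`: the complement of file 13's `closureEmb_geomSqrt_not_mem_maxUnramified_rat`
  (`v(d)` odd ⟹ `√d ∉ ℚ_v^{nr}`), in the same currency.

References: [SerreLocalFields1979] Ch. IV §4 Prop. 16, Cor. 2; [Serre1973] Ch. II §3.3 Thm. 4; [MazurRubin2010] Lemma 2.10 (v).
-/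

set_option linter.dupNamespace false -- tree convention: `Summit.BirchSwinnertonDyer.BirchSwinnertonDyer.Theorems` (summit = sub-problem)
set_option autoImplicit false

noncomputable section

open scoped Classical ValuativeRel

namespace Summit.BirchSwinnertonDyer.BirchSwinnertonDyer.Theorems.GenusKolyArch

open WeierstrassCurve Field NumberField IsDedekindDomain Function
open Literature.NumberTheory.EllipticCurves Literature.NumberTheory.GaloisRepresentations
open Literature.NumberTheory.EllipticCurves.TwoDescentLocal
open Rat.HeightOneSpectrum (primesEquiv)

/-! ## §86 `√d ∈ ℚ_v^{nr}` for `v ∣ 2`, `d ≡ 5 (mod 8)` -/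

/-- **`|n|_v = 1` for a natural number `n ∉ v`**, in the valuation of the valuative relation of `ℚ_v` (the currency of
`IsNonarchimedeanLocalField.maxUnramified`; transport of Mathlib's `valuation_lt_one_iff_mem` / `valuation_le_one`). [folklore] -/
theorem valuation_adicCompletion_natCast_eq_one_of_not_mem (v : HeightOneSpectrum (𝓞 ℚ)) (n : ℕ)
    (hn : ((n : ℕ) : 𝓞 ℚ) ∉ v.asIdeal) :
    ValuativeRel.valuation (v.adicCompletion ℚ) (n : v.adicCompletion ℚ) = 1 := by
  rw [← (ValuativeRel.isEquiv (Valued.v : Valuation (v.adicCompletion ℚ) (WithZero (Multiplicative ℤ)))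
    (ValuativeRel.valuation (v.adicCompletion ℚ))).eq_one_iff_eq_one]
  have h1 : (n : v.adicCompletion ℚ) = algebraMap (𝓞 ℚ) (v.adicCompletion ℚ) (n : 𝓞 ℚ) := by rw [map_natCast]
  have h2 : Valued.v (algebraMap (𝓞 ℚ) (v.adicCompletion ℚ) (n : 𝓞 ℚ)) = v.valuation ℚ (algebraMap (𝓞 ℚ) ℚ n) :=
    @HeightOneSpectrum.valuedAdicCompletion_eq_valuation (𝓞 ℚ) _ _ ℚ _ _ _ v (n : 𝓞 ℚ)
  rw [h1, h2]
  have hle : v.valuation ℚ (algebraMap (𝓞 ℚ) ℚ n) ≤ 1 := v.valuation_le_one (n : 𝓞 ℚ)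
  rcases hle.eq_or_lt with h | h
  · exact h
  · have hlt : v.valuation ℚ (algebraMap (𝓞 ℚ) ℚ n) < 1 ↔ (n : 𝓞 ℚ) ∈ v.asIdeal := v.valuation_lt_one_iff_mem (n : 𝓞 ℚ)
    exact absurd (hlt.mp h) hn

/-- `3 ∉ v` for the place `v` above `2`. [folklore] -/
theorem three_not_mem_of_two_mem (v : HeightOneSpectrum (𝓞 ℚ)) (h2 : ((2 : ℕ) : 𝓞 ℚ) ∈ v.asIdeal) :
    ((3 : ℕ) : 𝓞 ℚ) ∉ v.asIdeal := by
  intro h3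
  have h1 : (1 : 𝓞 ℚ) ∈ v.asIdeal := by
    have h := v.asIdeal.sub_mem h3 h2
    have e : ((3 : ℕ) : 𝓞 ℚ) - ((2 : ℕ) : 𝓞 ℚ) = 1 := by push_cast; norm_num
    rwa [e] at h
  exact v.isPrime.ne_top ((Ideal.eq_top_iff_one _).mpr h1)

/-- **A primitive cube root of unity lies in `ℚ_v^{nr} = ℚ_v(μ_{2'})` for `v ∣ 2`** (`3` is a unit of `𝒪_v`).
[cite: SerreLocalFields1979, Ch. IV §4 Cor. 2 to Prop. 16] -/
theorem exists_cubeRootOfUnity_mem_maxUnramified (v : HeightOneSpectrum (𝓞 ℚ)) (h2 : ((2 : ℕ) : 𝓞 ℚ) ∈ v.asIdeal) :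
    ∃ ζ : AlgebraicClosure (v.adicCompletion ℚ), ζ ^ 2 + ζ + 1 = 0 ∧
      ζ ∈ IsNonarchimedeanLocalField.maxUnramified (v.adicCompletion ℚ) := by
  -- `r² = −3`, `ζ = (r − 1)/2`
  obtain ⟨r, hr⟩ := IsAlgClosed.exists_pow_nat_eq (-3 : AlgebraicClosure (v.adicCompletion ℚ)) two_pos
  -- `2 ≠ 0` in `K̄_v` (no `CharZero` instance is registered: it would let `DivisionRing.toRatAlgebra` compete with the
  -- completion's `ℚ`-algebra structure)
  have h2K : (2 : AlgebraicClosure (v.adicCompletion ℚ)) ≠ 0 := by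
    rw [← map_ofNat (algebraMap ℚ (AlgebraicClosure (v.adicCompletion ℚ))) 2]
    exact (map_ne_zero _).mpr (by norm_num)
  refine ⟨(r - 1) / 2, ?_, IntermediateField.subset_adjoin _ _ ?_⟩
  · rw [div_pow, div_add_div _ _ (pow_ne_zero 2 h2K) h2K, div_add_one (mul_ne_zero (pow_ne_zero 2 h2K) h2K),
      div_eq_zero_iff]
    left
    linear_combination 2 * hr
  · refine (IsNonarchimedeanLocalField.mem_primeToPRootsOfUnity_iff).mpr ⟨3, ?_, ?_⟩
    · rw [Kramer1981.isUnit_integer_iff]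
      push_cast
      exact valuation_adicCompletion_natCast_eq_one_of_not_mem v 3 (three_not_mem_of_two_mem v h2)
    · have h8 : (r - 1) ^ 3 = 2 ^ 3 := by linear_combination (r - 3) * hr
      rw [div_pow, h8]
      exact div_self (pow_ne_zero 3 h2K)

/-- **`√d ∈ ℚ_v^{nr}` for `v ∣ 2` and `d ≡ 5 (mod 8)`**: the chosen copy `closureEmb(√d)` of `√d` in `K̄_{ℚ_v}` lies in the tree's maximal
unramified extension `ℚ_v(μ_{2'})`. Proof: `ζ₃ ∈ μ_{2'}`, `(2ζ₃+1)² = −3`, `−3d ≡ 1 (mod 8)` is a square `s²` in `ℚ_v`, and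
`(s(2ζ₃+1)/3)² = d`, so `closureEmb(√d) = ± s(2ζ₃+1)/3`. (For `v(d)` odd the copy lies OUTSIDE: file 13's
`closureEmb_geomSqrt_not_mem_maxUnramified_rat`.) [cite: SerreLocalFields1979, Ch. IV §4 Cor. 2 to Prop. 16] [cite: Serre1973, Ch. II §3.3 Thm. 4] -/
theorem closureEmb_geomSqrt_mem_maxUnramified_of_emod_eight_eq_five (v : HeightOneSpectrum (𝓞 ℚ))
    (hv : (primesEquiv v : ℕ) = 2) (h2 : ((2 : ℕ) : 𝓞 ℚ) ∈ v.asIdeal) {d : ℤ} (hd : d % 8 = 5) :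
    closureEmb (K := ℚ) (v.adicCompletion ℚ) (geomSqrt (d : ℚ)) ∈
      IsNonarchimedeanLocalField.maxUnramified (v.adicCompletion ℚ) := by
  -- (no `CharZero` instance is registered on the completion or its closure: it would let `DivisionRing.toRatAlgebra`
  -- compete with the completion's `ℚ`-algebra structure inside `closureEmb`; `3 ≠ 0` is taken from `ℚ` instead.)
  have h3K : (3 : AlgebraicClosure (v.adicCompletion ℚ)) ≠ 0 := by
    rw [← map_ofNat (algebraMap ℚ (AlgebraicClosure (v.adicCompletion ℚ))) 3]
    exact (map_ne_zero _).mpr (by norm_num)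
  obtain ⟨ζ, hζ, hζmem⟩ := exists_cubeRootOfUnity_mem_maxUnramified v h2
  -- `−3d` is a square in `ℚ_v`
  have h3d0 : ((-3 * d : ℤ) : ℚ) ≠ 0 := by exact_mod_cast (show (-3 * d : ℤ) ≠ 0 by omega)
  have h3dodd : ¬ (2 : ℤ) ∣ (-3 * d) := by omega
  have hpar : Even (padicValRat 2 ((-3 * d : ℤ) : ℚ)) := by
    rw [padicValRat.of_int, padicValInt.eq_zero_of_not_dvd h3dodd]
    exact Even.zero
  have h8 : res8 ((-3 * d : ℤ) : ℚ) = 1 := by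
    rw [res8_intCast h3dodd]
    have hmod : (-3 * d) % 8 = 1 % 8 := by omega
    have h := (ZMod.intCast_eq_intCast_iff' (-3 * d) 1 8).mpr hmod
    simpa using h
  obtain ⟨s, hs⟩ := isSquare_algebraMap_adicCompletion_two_of_res8 v hv h3d0 hpar h8
  -- squares, read against the integer cast `(d : K̄)`
  have hx2 : (closureEmb (K := ℚ) (v.adicCompletion ℚ) (geomSqrt (d : ℚ))) ^ 2 =
      ((d : ℤ) : AlgebraicClosure (v.adicCompletion ℚ)) := by
    rw [← map_pow, geomSqrt_sq, AlgHom.commutes, map_intCast]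
  have hζ3 : (2 * ζ + 1) ^ 2 = -3 := by linear_combination 4 * hζ
  have hs' : algebraMap (v.adicCompletion ℚ) (AlgebraicClosure (v.adicCompletion ℚ)) s ^ 2 =
      ((-3 * d : ℤ) : AlgebraicClosure (v.adicCompletion ℚ)) := by
    rw [← map_pow, pow_two, ← hs, map_intCast, map_intCast]
  have hy2 : (algebraMap (v.adicCompletion ℚ) (AlgebraicClosure (v.adicCompletion ℚ)) s * (2 * ζ + 1) / 3) ^ 2 =
      ((d : ℤ) : AlgebraicClosure (v.adicCompletion ℚ)) := by
    rw [div_pow, mul_pow, hs', hζ3, div_eq_iff (pow_ne_zero 2 h3K)]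
    push_cast
    ring
  have hymem : algebraMap (v.adicCompletion ℚ) (AlgebraicClosure (v.adicCompletion ℚ)) s * (2 * ζ + 1) / 3 ∈
      IsNonarchimedeanLocalField.maxUnramified (v.adicCompletion ℚ) := by
    refine div_mem (mul_mem (IntermediateField.algebraMap_mem _ s) ?_) ?_
    · exact add_mem (mul_mem (by exact_mod_cast natCast_mem (IsNonarchimedeanLocalField.maxUnramified _) 2) hζmem)
        (one_mem _)
    · exact_mod_cast natCast_mem (IsNonarchimedeanLocalField.maxUnramified (v.adicCompletion ℚ)) 3
  have key : ∀ z : AlgebraicClosure (v.adicCompletion ℚ), z ^ 2 = ((d : ℤ) : AlgebraicClosure (v.adicCompletion ℚ)) →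
      z ∈ IsNonarchimedeanLocalField.maxUnramified (v.adicCompletion ℚ) := by
    intro z hz
    rcases sq_eq_sq_iff_eq_or_eq_neg.mp (hz.trans hy2.symm) with h | h
    · rw [h]; exact hymem
    · rw [h]; exact neg_mem hymem
  exact key _ hx2

end Summit.BirchSwinnertonDyer.BirchSwinnertonDyer.Theorems.GenusKolyArch

end
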